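/-
Copyright (c) 2026. All rights reserved.
Released under Apache 2.0 license as described in the file LICENSE.
-/
import Literature.Probability.FitznerVanDerHofstad2017.NobleCodingMid
import HarnessLib

/-!
# [FvdH17] §4.4: the last pivotal bond CUTS — no open bond from the entry route to `b̲_i`

[FvdH17] = R. Fitzner, R. van der Hofstad, *Mean-field behavior for nearest-neighbor percolation in `d > 10`*,
Electron. J. Probab. **22** (2017) no. 43; arXiv:1506.07977v2, §4.4 (4.59)–(4.64) (v2 pp. 41–43).

`NobleCodingMid.exists_sausage_sdiff` produces, for `ω ∈ E′(v, y; A)`, the entry route `W₁ : v → t` to the first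
point `t` of the last sausage together with the clause (from `NobleCodingLevelOne.exists_lastPivot`)
"EVERY `t → y` path meets `W₁` only in `t`".  This module records the elementary consequence the block tables
of §5.1 / App. B use silently (Table `B^{(2),ι,a,b}`: "`B^{(2),ι,a,0} = B^{(2),ι,a,1} = 0`"; (5.4), second term):
a vertex `w ≠ t` of the entry route is NOT joined to `y = b̲_i` by an open bond — otherwise that bond, preceded
by the piece of `W₁` from `t` back to `w`, would be a `t → y` path through `w`.  Hence, in the `F″` coding
(`LaceCodingMidE`, `w_i` strictly before the last sausage), the exit pair `(b̲_i, w_i)` is never in length class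
`1` (and never in class `0`).  Pure graph theory; every `d`; nothing cited as a hypothesis.
-/

namespace Literature.Probability.FitznerVanDerHofstad2017

open _root_.SimpleGraph

/-! ### A. The graph lemma -/

section Graph

variable {V : Type*} {G : SimpleGraph V}

/-- **A cut clause forbids chords to the target.**  If every path from `t` to `y` meets the walk `W₁ : v → t`
only in `t`, and `y ∉ W₁`, then no vertex `w ≠ t` of `W₁` is adjacent to `y`.
[cite: FitznerVanDerHofstad2017, §4.4 after (4.64) ("the last sausage … t_i the first point of the last sausage") (arXiv:1506.07977v2 p. 42)] -/
theorem not_adj_of_forall_path_meets_only_at_end [DecidableEq V] {v t y : V} (W₁ : G.Walk v t)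
    (hcut : ∀ R : G.Walk t y, R.IsPath → ∀ x ∈ R.support, x ∈ W₁.support → x = t)
    (hW₁ : W₁.IsPath) (hy : y ∉ W₁.support) {w : V} (hw : w ∈ W₁.support) (hwt : w ≠ t) :
    ¬ G.Adj w y := by
  intro hadj
  -- the piece of `W₁` from `w` to `t`, a path not containing `y`
  set D : G.Walk w t := W₁.dropUntil w hw with hD
  have hDpath : D.IsPath := hW₁.dropUntil hw
  have hDsupp : ∀ x ∈ D.support, x ∈ W₁.support := fun x hx => W₁.support_dropUntil_subset_support hw hx
  have hyD : y ∉ D.support := fun h => hy (hDsupp y h)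
  -- `y → w → … → t`, reversed: a `t → y` path through `w`
  set R : G.Walk t y := (Walk.cons hadj.symm D).reverse with hR
  have hRpath : R.IsPath := by
    rw [hR]
    exact ((Walk.cons_isPath_iff hadj.symm D).2 ⟨hDpath, hyD⟩).reverse
  have hwR : w ∈ R.support := by
    rw [hR, Walk.support_reverse, List.mem_reverse, Walk.support_cons]
    exact List.mem_cons_of_mem _ D.start_mem_support
  exact hwt (hcut R hRpath w hwR hw)

end Graph

/-! ### B. The percolation reading: the bond `(w_i, b̲_i)` is closed in `F″` -/

section Perc

open Literature.Probability.Percolation Literature.Probability.LatticeModels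

variable {V : Type*}

/-- **In the `F″` geometry the exit pair is never in class `1`.**  For a bond configuration `η`, an entry route
`W₁ : v → t` (a path) such that every open `t → y` path meets `W₁` only in `t`, and `t ≠ y` with `y ∉ W₁`:
for every `w ∈ W₁` with `w ≠ t` the bond `s(w, y)` is not open.  (Apply to the data of
`NobleCodingMid.exists_sausage_sdiff`, whose clause `∀ R, R.IsPath → ∀ x ∈ R.support, x ∈ W₁.support → x = t`
is exactly `hcut`, and `y ∉ W₁.support` follows from it with `R :=` a sausage route and `t ≠ y`.)
[cite: FitznerVanDerHofstad2017, §4.4 (4.60) and after (4.64); App. B Table "B^{(2),ι,a,b}" rows b = 0, 1 (arXiv:1506.07977v2 pp. 41–42, 76)] -/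
theorem sym2_notMem_of_forall_path_meets_only_at_end [DecidableEq V] {η : BondConfig V} {v t y : V}
    (W₁ : (openGraph η).Walk v t)
    (hcut : ∀ R : (openGraph η).Walk t y, R.IsPath → ∀ x ∈ R.support, x ∈ W₁.support → x = t)
    (hW₁ : W₁.IsPath) (hy : y ∉ W₁.support) {w : V} (hw : w ∈ W₁.support) (hwt : w ≠ t) :
    s(w, y) ∉ η := by
  intro hmem
  have hwy : w ≠ y := fun h => hy (h ▸ hw)
  have hadj : (openGraph η).Adj w y := by
    change (SimpleGraph.fromEdgeSet η).Adj w y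
    rw [SimpleGraph.fromEdgeSet_adj]
    exact ⟨hmem, hwy⟩
  exact not_adj_of_forall_path_meets_only_at_end W₁ hcut hW₁ hy hw hwt hadj

/-- `y ∉ W₁` from the cut clause and ONE `t → y` path (e.g. a sausage route), when `t ≠ y`. [folklore] -/
theorem end_notMem_support_of_forall_path_meets_only_at_end {G : SimpleGraph V} {v t y : V}
    (W₁ : G.Walk v t)
    (hcut : ∀ R : G.Walk t y, R.IsPath → ∀ x ∈ R.support, x ∈ W₁.support → x = t)
    (P : G.Walk t y) (hP : P.IsPath) (hty : t ≠ y) : y ∉ W₁.support :=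
  fun hy => hty (hcut P hP y P.end_mem_support hy).symm

end Perc

end Literature.Probability.FitznerVanDerHofstad2017
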